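import Summits.BirchSwinnertonDyer.BirchSwinnertonDyer.Theorems.ThetaPartnerAtTwoSignedKatoUpToAtTwoPointsPackageTransfer
import Summits.BirchSwinnertonDyer.BirchSwinnertonDyer.Theorems.ThetaPartnerAtTwoSignedKatoUpToAtTwoOfPubInv
import HarnessLib

/-!
# Route `ThetaPartnerAtTwo` (TP2), crux K3 `SignedKatoDivisibilityUpToAtTwo` (item stmt-BirchSwinnertonDyer-20308),
# line `colemanrat` v6 — THE CERTIFICATE «K3 BY NAME ⟸ {Kato Thm. 13.4 (2) at 2 print-exact, GZK, (R2b)}»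

Lead `bsd-wall-tp2-p2x` g4 (cell `bsd-wall`). HONEST FRAMING: ONE THEOREM, a composition of landed theorems (no definition, no named
fact declared, no instance, no `sorry`). It is a CONDITIONAL certificate: its three hypotheses are the Literature named fact
`Kato2004.thm13_4_two_lengthAt_fineSelmerDualContra_le_of_isEulerSystemClassTwo` (Kato Thm. 13.4 (2) at `p = 2`, contragredient fine
dual, print-exact; unproved in the tree), `rank_eq_analyticRank_of_analyticRank_le_one` (Gross–Zagier–Kolyvagin; unproved in the tree) and
the registered research stub (R2b) `Cruxes.SignedKatoDivisibilityUpToAtTwo.ColemanRat.stub_h1SideTwoInv` of skeleton v6 (the `𝐇¹`-side: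
local Tate pairing map + raw global reciprocity + Euler-system class + explicit reciprocity at 2 in ♭-Coleman currency). It closes no
item; BSD is NOT proved by any of this. Composition: the width seats' `…OfPubInv` certificate (K3 ⟸ {Kato-contra, GZK, (R2^ι)}, via
w2's CHAIN^ι and w3's `katoBoundTwoInv_of_contra`) ∘ the lead's transfer `localRobustPackageTwoInv_of_h1SideTwoInv` ((R2b) → (R2^ι)).

## What is proved
* `SignedKatoOffTwo.signedKatoDivisibilityUpToAtTwo_of_contraFact_of_gzk_of_h1Side` — K3 by name from the two published facts and (R2b).

References: [Kato2004Asterisque] Thm. 12.5, 13.4 (2), §17.13; [Kobayashi2003] Thm. 6.3, 7.3; [GrossZagier1986]; [Kolyvagin1990].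
-/

set_option autoImplicit false
-- the Theorems namespace of this sub repeats the summit name by design (D-0017 nested layout)
set_option linter.dupNamespace false

noncomputable section

open scoped Classical MatrixGroups ModularForm NumberField

open CongruenceSubgroup WeierstrassCurve Field IsDedekindDomain NumberField
  Literature.NumberTheory.GaloisRepresentations
  Literature.NumberTheory.EllipticCurves Literature.NumberTheory.EllipticCurves.ModularForms
  Literature.NumberTheory.EllipticCurves.Module Literature.NumberTheory.EllipticCurves.Rank1Residual
  Literature.NumberTheory.EllipticCurves.Kobayashi2003 Literature.NumberTheory.EllipticCurves.Kato2004
  Literature.NumberTheory.EllipticCurves.Kato2004.EulerSystemValues Literature.NumberTheory.EllipticCurves.GreenbergSelmer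
  Literature.NumberTheory.EllipticCurves.Sprung2012
  ZpExtension Summit.BirchSwinnertonDyer.Rank1Residual.Supersingular

namespace Summit.BirchSwinnertonDyer.BirchSwinnertonDyer.Theorems.SignedKatoOffTwo

/-- **K3 BY NAME from {Kato Thm. 13.4 (2) at `2` (print-exact, contragredient fine dual), GZK} and the `𝐇¹`-side (R2b).**
Hypotheses: (1) the Literature named fact `Kato2004.thm13_4_two_lengthAt_fineSelmerDualContra_le_of_isEulerSystemClassTwo`;
(2) `rank_eq_analyticRank_of_analyticRank_le_one`; (3) the registered stub (R2b) `stub_h1SideTwoInv` VERBATIM. Conclusion: the crux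
`SignedKatoDivisibilityUpToAtTwo` of route TP2. Composition: `IwasawaInvolution.signedKatoDivisibilityUpToAtTwo_of_contraFact_of_gzk_of_packageInv`
∘ `localRobustPackageTwoInv_of_h1SideTwoInv`. CONDITIONAL on (1)–(3); closes nothing by itself.
[cite: Kato2004Asterisque, Thm. 13.4 (2) (p. 226), Thm. 12.5 (p. 222), §17.13 (p. 279)] [cite: Kobayashi2003, Thm. 6.3 (p. 11), Thm. 7.3 (pp. 12–13)] -/
theorem signedKatoDivisibilityUpToAtTwo_of_contraFact_of_gzk_of_h1Side
    (hK2 : Kato2004.thm13_4_two_lengthAt_fineSelmerDualContra_le_of_isEulerSystemClassTwo)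
    (hGZK : rank_eq_analyticRank_of_analyticRank_le_one)
    (hR2b : ∀ (v : HeightOneSpectrum (𝓞 ℚ)), ((2 : ℕ) : 𝓞 ℚ) ∈ v.asIdeal →
      ∀ (W : WeierstrassCurve ℚ) [W.IsElliptic] [W.IsGloballyMinimal],
        ¬ W.HasCM → W.analyticRank = 0 → GoodSS W 2 → W.frobeniusTrace 2 = 0 →
        ∀ (κ : ZpExtension ℚ 2) (γ : Field.absoluteGaloisGroup ℚ) (hκ : κ.IsCyclotomic),
          κ.IsTopGenerator γ → IsCyclotomicVariable 2 γ →
          ∀ [NeZero (W.conductorNorm ℤ)] (f : CuspForm (Gamma0 (W.conductorNorm ℤ)) 2),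
            IsNewformOf W f → ∀ (ϖ : ℚ), (ϖ : ℝ) * W.realPeriodRat = plusPeriod f →
          ∀ (Lplus Lminus : IwasawaAlgebra 2), IsPollackPair f 2 Lplus Lminus →
          ∀ [ContinuousSMul ℤ_[2] (W.tateModule 2)] [Module.Free ℤ_[2] (W.tateModule 2)]
            [Module.Finite ℤ_[2] (W.tateModule 2)],
          ∀ 𝔭 : PrimeSpectrum (IwasawaAlgebra 2), 𝔭.asIdeal.height = 1 →
            PowerSeries.C (2 : ℤ_[2]) ∉ 𝔭.asIdeal →
          ∃ (g : absoluteGaloisGroup (v.adicCompletion ℚ))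
            (hg : κ.IsTopGenerator (resGalOfEmb (closureEmb (K := ℚ) (v.adicCompletion ℚ)) g))
            (d : ℕ → localPoints W (v.adicCompletion ℚ))
            (I : Kato2004.IwasawaH1Data W 2 κ γ)
            (col₀ : I.H →+ (localTowerPointsOfEmb κ (closureEmb (K := ℚ) (v.adicCompletion ℚ)) W →+ ℤ_[2]))
            (s : I.H) (m : ℕ),
            (∀ n, d n ∈ localLayerPointsOfEmb κ (closureEmb (K := ℚ) (v.adicCompletion ℚ)) W n) ∧
            (∀ n, localTraceOfEmb κ (closureEmb (K := ℚ) (v.adicCompletion ℚ)) W (n + 1) (n + 2) (d (n + 2)) = -d n) ∧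
            (∀ n : ℕ, 1 ≤ n → ∀ P ∈ localLayerPointsOfEmb κ (closureEmb (K := ℚ) (v.adicCompletion ℚ)) W n,
              ∃ B ∈ AddSubgroup.closure (Set.range fun σ : absoluteGaloisGroup (v.adicCompletion ℚ) ↦ σ • d n),
                ∃ P' ∈ localLayerPointsOfEmb κ (closureEmb (K := ℚ) (v.adicCompletion ℚ)) W (n - 1),
                ∃ R ∈ localLayerPointsOfEmb κ (closureEmb (K := ℚ) (v.adicCompletion ℚ)) W n, P = B + P' + 2 • R) ∧
            (∀ P ∈ localLayerPointsOfEmb κ (closureEmb (K := ℚ) (v.adicCompletion ℚ)) W 0,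
              ∃ a : ℤ, ∃ R ∈ localLayerPointsOfEmb κ (closureEmb (K := ℚ) (v.adicCompletion ℚ)) W 0, P = a • d 0 + 2 • R) ∧
            (∀ (r : IwasawaAlgebra 2) (x : I.H),
              col₀ (r • x) = lambdaSMul κ (closureEmb (K := ℚ) (v.adicCompletion ℚ)) W hg r (col₀ x)) ∧
            (∀ (x : I.H) (t : W.subgroupH1 2 κ.kerSubgroup), t ∈ signedSelmerInfty W κ 1 →
              ∀ (φ : contOneCocycles (discreteTopRep κ.kerSubgroup (W.geomPrimaryTorsion 2)))
                (Q : localPoints W (v.adicCompletion ℚ)) (k : ℕ), oneCocycleClass _ φ = t →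
              ∀ hQ : 2 ^ k • Q ∈ (⨆ n, signedLocalPoints κ (v.adicCompletion ℚ) W 1 n),
              (∀ τ : localSubgroupOfEmb κ.kerSubgroup (closureEmb (K := ℚ) (v.adicCompletion ℚ)),
                pointsMapOfEmb W (closureEmb (K := ℚ) (v.adicCompletion ℚ))
                    ((φ.1 (resGalSubgroupOfEmb κ.kerSubgroup _ τ) : W.geomPrimaryTorsion 2) : W.geomPoints) =
                  (τ : absoluteGaloisGroup (v.adicCompletion ℚ)) • Q - Q) →
              (PadicInt.toZModPow k
                  (col₀ ((PowerSeries.C (2 : ℤ_[2]) : IwasawaAlgebra 2) ^ m • x)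
                    ⟨2 ^ k • Q, KummerPoint.iSup_signedLocalPoints_le_localTowerPointsOfEmb W 2 κ 1 v hQ⟩)).val •
                ((((2 : ℚ) ^ k)⁻¹ : ℚ) : AddCircle (1 : ℚ)) = 0) ∧
            Kato2004.IsEulerSystemClassTwo W hκ I s ∧
            (∀ Ls Lf : IwasawaAlgebra 2,
              IsColemanPair κ (closureEmb (K := ℚ) (v.adicCompletion ℚ)) W 0 g d (col₀ s) Ls Lf →
              lengthAt (IwasawaAlgebra 2) (IwasawaAlgebra 2 ⧸ Ideal.span {Lf}) 𝔭 ≤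
                lengthAt (IwasawaAlgebra 2) (IwasawaAlgebra 2 ⧸ Ideal.span {kobayashiL 1 Lplus Lminus}) 𝔭)) :
    Summit.BirchSwinnertonDyer.BirchSwinnertonDyer.Theses.ThetaPartnerAtTwo.SignedKatoDivisibilityUpToAtTwo :=
  IwasawaInvolution.signedKatoDivisibilityUpToAtTwo_of_contraFact_of_gzk_of_packageInv hK2 hGZK
    (localRobustPackageTwoInv_of_h1SideTwoInv hR2b)

end Summit.BirchSwinnertonDyer.BirchSwinnertonDyer.Theorems.SignedKatoOffTwo

end
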